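import Summits.BirchSwinnertonDyer.BirchSwinnertonDyer.Theorems.SignedBaseChangeDefiniteAnchorDefs
import Summits.BirchSwinnertonDyer.BirchSwinnertonDyer.Theorems.SignedBaseChangeAnticyclotomicEisensteinDivisibilityAdmdefAnchorIffNV
import HarnessLib

/-!
# Crux `DefiniteAnchorNonFW` (stmt-BirchSwinnertonDyer-33118) — Negative lane: which binders of «(Anch)_¬FW» are load-bearing

Refuter ∕ disprover unit `cdisprove-stmt-BirchSwinnertonDyer-33118-g0` (explicit unit of director-bsd (635)(m); crux item
stmt-BirchSwinnertonDyer-33118, `Theorems.SignedBaseChangeDefiniteAnchorDefs.DefiniteAnchorNonFW`, route `SignedBaseChange`, line `admdef`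
of crux 20727).  Companion of the crux work file `Cruxes/DefiniteAnchorNonFW/Disproof.lean` (verdict NO KILL); this file holds the three
kernel facts of that analysis that are worth importing:

* `selQP_eq_bot_of_anchor` — **an anchor forces its own zero vertex.**  In CHKLL25's frame (signed bipartite system `hB` at level
  `N = N_E`, `Setting`, {HLV 3.7 local} `hloc`, the dictionary `hdict`, multiplicity one `hmult`, (Par) `hodd`; all HYPOTHESES), definite
  Brandt data with a non-zero weighted toric period at an ODD admissible level `s` (the conclusion of the crux, verbatim) give
  `λ_1(∏s)(0) ∈ ℤ_pˣ` and [NV] (tree `hasUnitLambda_of_anchorAt`), whence BOTH eigen-Selmer spaces vanish at `s` (Howard 3.2.3 (c) as an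
  iff, tree `isUnit_lam_iff_selQP_eq_bot_of_hasUnitLambda'`).  Consequence for the crux: its zero-vertex binder `∀ μ, SelQP W K p c n μ = ⊥`
  is LOAD-BEARING — the text with that binder deleted is refuted by any cell-β datum in the frame with one odd level carrying a non-zero
  eigen-Selmer class (`Disproof.withoutSelZero_false_of_selQP_ne_bot`); any proof of the crux must use `Sel_n^± = 0`.
* `not_anchor_of_even_card` — **the conclusion of the crux is unsatisfiable at even levels**: a definite set-up of type `(N, ∏ n)` is
  ramified exactly at the `#n` primes of `n` and at `∞`, so `#n` is odd (tree `XiSetup.odd_card_primeFactors`, Hilbert reciprocity over `ℚ`).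
  The binder `Odd n.card` cannot be dropped as typed.
* `isEmpty_admQ_of_lt_five` ∕ `not_odd_card_of_lt_five` — for a prime `p < 5` there are no Bertolini–Darmon admissible primes, so no level is
  odd: the binder `5 ≤ p` of the crux is NOT load-bearing (the crux with it deleted is equivalent to the crux, `Disproof.withoutFiveLe_iff`).

HONEST FRAMING. Nothing here proves or refutes the crux, [NV], crux 20727 or BSD; the frame hypotheses are hypotheses.  No `sorry`, no new
axiom, standard axioms only.
References: [cite: Howard2006, Thm. 3.2.3 (c), Lem. 2.3.4] [cite: CastellaEtAl2025, Thm. 7.4, Thm. 7.5, Thm. 7.6, §7.4] [cite: KimOta2023, Thm. 5.5, Cor. 5.7]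
[cite: VignerasLNM800, Ch. III §3 Thm. 3.1] [cite: BertoliniDarmon2005, p. 18, p. 22] [cite: WZhang2014, p. 195, Thm. 9.1]
-/

-- D-0017: single-problem summit, the namespace repeats the problem name by design.
set_option linter.dupNamespace false
set_option autoImplicit false

noncomputable section

open scoped Classical NumberField Pointwise

namespace Summit.BirchSwinnertonDyer.BirchSwinnertonDyer.Theorems.DefiniteAnchorNonFWNegative

open WeierstrassCurve NumberField IsDedekindDomain Field Module
open Literature.NumberTheory.EllipticCurves Literature.NumberTheory.EllipticCurves.ModularForms
open Literature.NumberTheory.EllipticCurves.Rank1Residual Literature.NumberTheory.GaloisRepresentations Literature.NumberTheory.GaloisCohomology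
open Literature.NumberTheory.EllipticCurves.CastellaHsuKunduLeeLiu2025
open Literature.NumberTheory.EllipticCurves.BertoliniDarmon2005
open Literature.NumberTheory.EllipticCurves.AcSigned
open Literature.NumberTheory.Automorphic
open Summit.BirchSwinnertonDyer.BirchSwinnertonDyer.Theorems
open Summit.BirchSwinnertonDyer.BirchSwinnertonDyer.Theorems.AdditiveKoly
open Summit.BirchSwinnertonDyer.BirchSwinnertonDyer.Theorems.SignedBaseChangeDefiniteAnchorDefs
open Summit.BirchSwinnertonDyer.BirchSwinnertonDyer.Theorems.SignedBaseChangeAcDivAdmdefHowardRigidity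
open Summit.BirchSwinnertonDyer.BirchSwinnertonDyer.Theorems.SignedBaseChangeAcDivAdmdefAnchorOfNV
open Summit.BirchSwinnertonDyer.BirchSwinnertonDyer.Theorems.SignedBaseChangeAcDivAdmdefAnchorIffNV

/-! ## The binder `5 ≤ p` is not load-bearing -/

section FiveLe

variable {K : Type} [Field K] {W : WeierstrassCurve ℚ} [W.IsGloballyMinimal] {p : ℕ}

/-- For a prime `p < 5` there are NO Bertolini–Darmon admissible primes (`p = 2, 3`: the clause `p ∤ q² − 1` fails for every prime `q ≠ p`;
tree `three_lt_of_isAdmissiblePrime`). [cite: BertoliniDarmon2005, p. 22] -/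
theorem isEmpty_admQ_of_lt_five (hp : p.Prime) (h : p < 5) : IsEmpty (AdmQ W K p) := by
  refine ⟨fun q ↦ ?_⟩
  have h3 := three_lt_of_isAdmissiblePrime hp q.2
  have h4 : p ≠ 4 := by rintro rfl; exact absurd hp (by norm_num)
  omega

/-- Hence for `p < 5` every level is empty and no level is odd: the body of the crux is VACUOUSLY true below `5`, i.e. its binder `5 ≤ p`
is not load-bearing. [cite: BertoliniDarmon2005, p. 22] -/
theorem not_odd_card_of_lt_five (hp : p.Prime) (h : p < 5) (n : Finset (AdmQ W K p)) : ¬ Odd n.card := by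
  haveI := isEmpty_admQ_of_lt_five (W := W) (K := K) hp h
  rw [Finset.eq_empty_of_isEmpty n, Finset.card_empty]
  exact Nat.not_odd_iff_even.mpr Even.zero

end FiveLe

/-! ## The binder `Odd n.card` is forced by the conclusion -/

section OddLevel

variable {K : Type} [Field K] [NumberField K] {W : WeierstrassCurve ℚ} [W.IsGloballyMinimal] {p N : ℕ}

omit [NumberField K] in
/-- **No definite set-up at an EVEN level**: a set-up of type `(N, ∏ n)` is ramified exactly at the `#n` primes of `n` and at `∞`, and the
number of ramified places of a rational quaternion algebra is even (tree `XiSetup.odd_card_primeFactors`). [cite: VignerasLNM800, Ch. III §3 Thm. 3.1] -/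
theorem isEmpty_xiSetup_of_even_card {n : Finset (AdmQ W K p)} (hn : Even n.card) :
    IsEmpty (Brandt.XiSetup N (∏ q ∈ n.image Subtype.val, q)) := by
  refine ⟨fun S ↦ ?_⟩
  have hodd := S.odd_card_primeFactors
  rw [prod_image_val_eq_prod, card_primeFactors_prod] at hodd
  exact (Nat.not_even_iff_odd.mpr hodd) hn

/-- **The conclusion of the crux (verbatim) is UNSATISFIABLE at even levels** — so its binder `Odd n.card` cannot be dropped as typed.
[cite: VignerasLNM800, Ch. III §3 Thm. 3.1] -/
theorem not_anchor_of_even_card [Fact p.Prime] {n : Finset (AdmQ W K p)} (hn : Even n.card) :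
    ¬ ∃ (S : Brandt.XiSetup N (∏ q ∈ n.image Subtype.val, q)) (ψ : K →ₐ[ℚ] S.D) (I : Submodule ℤ S.D)
        (φ : Brandt.ClassSet S.O → ZMod p),
        Brandt.IsGrossPoint S.O ψ I ∧
        (letI : Fintype (Brandt.ClassSet S.O) := Fintype.ofFinite _
         φ ∈ Brandt.eigenSpace (ZMod p) (N * ∏ q ∈ n.image Subtype.val, q) (Brandt.matrix S.O) (fun ℓ ↦ W.frobeniusTrace ℓ)) ∧
        Brandt.toricPeriod S.O ψ I (fun i ↦ (Brandt.weight S.O i : ZMod p) * φ i) ≠ 0 := by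
  rintro ⟨S, -⟩
  exact (isEmpty_xiSetup_of_even_card (N := N) hn).false S

end OddLevel

/-! ## The zero-vertex binder is load-bearing: an anchor forces its own zero vertex -/

section Frame

variable {K : Type} [Field K] [NumberField K] {W : WeierstrassCurve ℚ} [W.IsElliptic] [W.IsGloballyMinimal] {p : ℕ} [Fact p.Prime]
  {κ : ZpExtension K p} {γ : absoluteGaloisGroup K} {N : ℕ} {ε : ℤˣ} {B : SignedBipartiteSystem W K p κ} {𝔭 𝔭' : HeightOneSpectrum (𝓞 K)}
  (c : K ≃ₐ[ℚ] K) [Module (ZMod p) (Vp W K p)]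

/-- ★ **AN ANCHOR FORCES ITS OWN ZERO VERTEX** (Howard's vanishing direction; kernel modulo CHKLL25's frame as HYPOTHESES): in the frame of
`…AdmdefAnchorIffNV` — signed bipartite system `hB` at level `N = N_E`, `Setting`, {HLV 3.7 local} `hloc`, `p ≥ 5`, `ρ̄` onto, Heegner
hypothesis, `p` split, `(N, d_K) = 1`, binder (ii) `hall`, `c ≠ 1`, (Par) `hodd`, the dictionary `hdict` and multiplicity one `hmult` —
definite Brandt data with non-zero weighted toric period at an ODD level `s` (the conclusion of `DefiniteAnchorNonFW` ∕ `DefiniteAnchorFW`,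
verbatim) give `λ_1(∏s)(0) ∈ ℤ_pˣ` and [NV] (`hasUnitLambda_of_anchorAt`), whence `Sel_s^± = 0`
(`isUnit_lam_iff_selQP_eq_bot_of_hasUnitLambda'`, Howard 3.2.3 (c) as an iff).  So anchors live ONLY at zero vertices, and the crux's
binder `∀ μ, SelQP W K p c n μ = ⊥` is load-bearing: any proof of the crux must use it.
[cite: Howard2006, Thm. 3.2.3 (c), Lem. 2.3.4] [cite: CastellaEtAl2025, Thm. 7.4, Thm. 7.5, §7.4] [cite: KimOta2023, Thm. 5.5, Cor. 5.7] -/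
theorem selQP_eq_bot_of_anchor [NeZero N] (hB : IsSignedBipartiteSystem W K p κ γ N ε B) (hS : Setting W K p κ 𝔭 𝔭')
    (hloc : hatleyLeiVigni2022_lemma37_local_signedCondition_eq_kummer W K p κ 𝔭 𝔭')
    (hN : (N : ℤ) = W.conductorNorm ℤ) (h5 : 5 ≤ p) (hsurj : W.HasSurjectiveModNGaloisRep p)
    (hHeeg : ∀ ℓ : ℕ, ℓ.Prime → ℓ ∣ N → ((Ideal.span {(ℓ : ℤ)}).primesOver (𝓞 K)).ncard = 2)
    (hsp : ((Ideal.span {(p : ℤ)}).primesOver (𝓞 K)).ncard = 2) (hND : IsCoprime (N : ℤ) (NumberField.discr K))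
    (hall : ∀ q : ℕ, q.Prime → q ∣ N → ∃ v' : HeightOneSpectrum (𝓞 ℚ), ((q : ℕ) : 𝓞 ℚ) ∈ v'.asIdeal ∧
      ∃ 𝔓 ∈ v'.primesAbove, ∃ σ ∈ 𝔓.inertia (absoluteGaloisGroup ℚ), ∃ P : W.geomTorsion (p : ℤ), σ • P ≠ P)
    (hc1 : c ≠ 1) (hodd : Odd (finrank (ZMod p) (SelQP W K p c ∅ true) + finrank (ZMod p) (SelQP W K p c ∅ false)))
    (hdict : ∀ m ∈ defProducts N K (fun ℓ ↦ W.frobeniusTrace ℓ) p 1, ∀ (S : Brandt.XiSetup N m),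
      ∃ φ : Brandt.ClassSet S.O → ZMod p, φ ≠ 0 ∧
        (letI : Fintype (Brandt.ClassSet S.O) := Fintype.ofFinite _
         φ ∈ Brandt.eigenSpace (ZMod p) (N * m) (Brandt.matrix S.O) (fun ℓ ↦ W.frobeniusTrace ℓ)) ∧
        ∀ (ψ : K →ₐ[ℚ] S.D) (I : Submodule ℤ S.D), Brandt.IsGrossPoint S.O ψ I →
          (IsUnit (PowerSeries.constantCoeff (B.lam 1 m)) ↔ Brandt.toricPeriod S.O ψ I (fun i ↦ (Brandt.weight S.O i : ZMod p) * φ i) ≠ 0))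
    (hmult : ∀ m ∈ defProducts N K (fun ℓ ↦ W.frobeniusTrace ℓ) p 1, ∀ (S : Brandt.XiSetup N m)
      (φ₁ φ₂ : Brandt.ClassSet S.O → ZMod p),
      (letI : Fintype (Brandt.ClassSet S.O) := Fintype.ofFinite _
       φ₁ ∈ Brandt.eigenSpace (ZMod p) (N * m) (Brandt.matrix S.O) (fun ℓ ↦ W.frobeniusTrace ℓ)) →
      (letI : Fintype (Brandt.ClassSet S.O) := Fintype.ofFinite _
       φ₂ ∈ Brandt.eigenSpace (ZMod p) (N * m) (Brandt.matrix S.O) (fun ℓ ↦ W.frobeniusTrace ℓ)) →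
      φ₁ ≠ 0 → ∃ a : ZMod p, φ₂ = a • φ₁)
    {s : Finset (AdmQ W K p)} (hs : Odd s.card)
    (hanch : ∃ (S : Brandt.XiSetup N (∏ q ∈ s.image Subtype.val, q)) (ψ : K →ₐ[ℚ] S.D) (I : Submodule ℤ S.D)
      (φ : Brandt.ClassSet S.O → ZMod p),
      Brandt.IsGrossPoint S.O ψ I ∧
      (letI : Fintype (Brandt.ClassSet S.O) := Fintype.ofFinite _
       φ ∈ Brandt.eigenSpace (ZMod p) (N * ∏ q ∈ s.image Subtype.val, q) (Brandt.matrix S.O) (fun ℓ ↦ W.frobeniusTrace ℓ)) ∧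
      Brandt.toricPeriod S.O ψ I (fun i ↦ (Brandt.weight S.O i : ZMod p) * φ i) ≠ 0) :
    ∀ μ : Bool, SelQP W K p c s μ = ⊥ := by
  have hN' : N = W.conductorNorm ℤ := by exact_mod_cast hN
  have hH : SatisfiesHeegnerHypothesis (W.conductorNorm ℤ) K := fun ℓ hℓ hℓN ↦ hHeeg ℓ hℓ (hN' ▸ hℓN)
  obtain ⟨hlam, hNV⟩ := hasUnitLambda_of_anchorAt hN hdict hmult hs hanch
  exact (isUnit_lam_iff_selQP_eq_bot_of_hasUnitLambda' c hB hS hloc hN h5 hsurj hH hsp hND hall hc1 hodd hNV hs).mp hlam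

/-- **Contrapositive, the shape a planner quotes**: in the frame, an odd level carrying a NON-ZERO eigen-Selmer class carries NO anchor —
the only candidate counterexample levels to the crux are its zero vertices, and the `SelZero`-less text of the crux is false as soon as one
cell-β datum in the frame has such a level. [cite: Howard2006, Thm. 3.2.3 (c)] [cite: CastellaEtAl2025, Thm. 7.4, Thm. 7.5, §7.4] -/
theorem not_anchor_of_selQP_ne_bot [NeZero N] (hB : IsSignedBipartiteSystem W K p κ γ N ε B) (hS : Setting W K p κ 𝔭 𝔭')
    (hloc : hatleyLeiVigni2022_lemma37_local_signedCondition_eq_kummer W K p κ 𝔭 𝔭')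
    (hN : (N : ℤ) = W.conductorNorm ℤ) (h5 : 5 ≤ p) (hsurj : W.HasSurjectiveModNGaloisRep p)
    (hHeeg : ∀ ℓ : ℕ, ℓ.Prime → ℓ ∣ N → ((Ideal.span {(ℓ : ℤ)}).primesOver (𝓞 K)).ncard = 2)
    (hsp : ((Ideal.span {(p : ℤ)}).primesOver (𝓞 K)).ncard = 2) (hND : IsCoprime (N : ℤ) (NumberField.discr K))
    (hall : ∀ q : ℕ, q.Prime → q ∣ N → ∃ v' : HeightOneSpectrum (𝓞 ℚ), ((q : ℕ) : 𝓞 ℚ) ∈ v'.asIdeal ∧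
      ∃ 𝔓 ∈ v'.primesAbove, ∃ σ ∈ 𝔓.inertia (absoluteGaloisGroup ℚ), ∃ P : W.geomTorsion (p : ℤ), σ • P ≠ P)
    (hc1 : c ≠ 1) (hodd : Odd (finrank (ZMod p) (SelQP W K p c ∅ true) + finrank (ZMod p) (SelQP W K p c ∅ false)))
    (hdict : ∀ m ∈ defProducts N K (fun ℓ ↦ W.frobeniusTrace ℓ) p 1, ∀ (S : Brandt.XiSetup N m),
      ∃ φ : Brandt.ClassSet S.O → ZMod p, φ ≠ 0 ∧
        (letI : Fintype (Brandt.ClassSet S.O) := Fintype.ofFinite _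
         φ ∈ Brandt.eigenSpace (ZMod p) (N * m) (Brandt.matrix S.O) (fun ℓ ↦ W.frobeniusTrace ℓ)) ∧
        ∀ (ψ : K →ₐ[ℚ] S.D) (I : Submodule ℤ S.D), Brandt.IsGrossPoint S.O ψ I →
          (IsUnit (PowerSeries.constantCoeff (B.lam 1 m)) ↔ Brandt.toricPeriod S.O ψ I (fun i ↦ (Brandt.weight S.O i : ZMod p) * φ i) ≠ 0))
    (hmult : ∀ m ∈ defProducts N K (fun ℓ ↦ W.frobeniusTrace ℓ) p 1, ∀ (S : Brandt.XiSetup N m)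
      (φ₁ φ₂ : Brandt.ClassSet S.O → ZMod p),
      (letI : Fintype (Brandt.ClassSet S.O) := Fintype.ofFinite _
       φ₁ ∈ Brandt.eigenSpace (ZMod p) (N * m) (Brandt.matrix S.O) (fun ℓ ↦ W.frobeniusTrace ℓ)) →
      (letI : Fintype (Brandt.ClassSet S.O) := Fintype.ofFinite _
       φ₂ ∈ Brandt.eigenSpace (ZMod p) (N * m) (Brandt.matrix S.O) (fun ℓ ↦ W.frobeniusTrace ℓ)) →
      φ₁ ≠ 0 → ∃ a : ZMod p, φ₂ = a • φ₁)
    {s : Finset (AdmQ W K p)} (hs : Odd s.card) {μ : Bool} (hne : SelQP W K p c s μ ≠ ⊥) :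
    ¬ ∃ (S : Brandt.XiSetup N (∏ q ∈ s.image Subtype.val, q)) (ψ : K →ₐ[ℚ] S.D) (I : Submodule ℤ S.D)
        (φ : Brandt.ClassSet S.O → ZMod p),
        Brandt.IsGrossPoint S.O ψ I ∧
        (letI : Fintype (Brandt.ClassSet S.O) := Fintype.ofFinite _
         φ ∈ Brandt.eigenSpace (ZMod p) (N * ∏ q ∈ s.image Subtype.val, q) (Brandt.matrix S.O) (fun ℓ ↦ W.frobeniusTrace ℓ)) ∧
        Brandt.toricPeriod S.O ψ I (fun i ↦ (Brandt.weight S.O i : ZMod p) * φ i) ≠ 0 :=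
  fun hanch ↦ hne (selQP_eq_bot_of_anchor c hB hS hloc hN h5 hsurj hHeeg hsp hND hall hc1 hodd hdict hmult hs hanch μ)

end Frame

end Summit.BirchSwinnertonDyer.BirchSwinnertonDyer.Theorems.DefiniteAnchorNonFWNegative

end
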